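import Mathlib.Analysis.Calculus.FDeriv.Prod
import Literature.Analysis.Calculus.CoordinateJets
import Literature.Analysis.FunctionSpaces.HolderBallData
import HarnessLib

/-!
# Differentiating a fully nonlinear second-order equation: the data of the differentiated problem

Topic `Literature/Analysis/PDE`.  The higher interior regularity of a `C^{2,α}` solution `v` of a
fully nonlinear equation `H(c(y), cjet₂ v(y)) = 0` (`H` smooth on `P × CJet ι 2`, `c` a
coefficient map into a finite-dimensional parameter space `P`, `cjet₂ v` the coordinate `2`-jet of
`Literature/Analysis/Calculus/CoordinateJets.lean`) is proved by induction on the order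
(Gilbarg–Trudinger 2001, Lemma 17.16): once `v ∈ C^{3,α}`, each directional derivative
`v_k = ∂_{e_k} v` solves the DIFFERENTIATED equation

  `DH(c(y), cjet₂ v(y)) · (∂_{e_k} c(y), cjet₂ v_k(y)) = 0`

(`Literature.Analysis.Calculus.fderiv_apply_eq_zero_of_comp_prod_cjetOf`), which is again of
the form `H♯(c♯(y), cjet₂ v_k(y)) = 0` with the ENLARGED parameter space
`P♯ = P × (CJet ι 2 × P)`, the structure function
`H♯((p, J₀, p₁), J) = DH(p, J₀) · (p₁, J)` and the coefficient map
`c♯(y) = (c(y), cjet₂ v(y), ∂_{e_k} c(y))`.  This file supplies what the induction hypothesis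
needs about the differentiated problem, as fully proved lemmas about these explicit lambdas (no
definitions):

* `contDiff_linearisedStructure` — `H♯` is smooth when `H` is;
* `fderiv_linearisedStructure_apply_zero` — in a direction `(0, X)` the derivative of `H♯` at
  `((p, J₀, p₁), J)` is `DH(p, J₀) · (0, X)`: the principal symbol of the differentiated equation
  is that of the original one, read at the first components;
* `linearisedStructure_elliptic_near` — hence uniform ellipticity of `H` on a `δ`-neighbourhood of
  the graph `(c, cjet₂ v)` transfers to `H♯` on the `δ`-neighbourhood of the graph of `c♯`
  (sup norm on the product), with the same constants;
* `holderData_cjetOf` — `C^{n+m,α}` data of `v` on a ball give `C^{n,α}` data of the jet map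
  `cjet_m v` (`Literature/Analysis/FunctionSpaces/HolderBallData.lean`);
* `holderData_fderiv_apply_basis_two`, `holderData_linearisedCoeff` — the `C^{2,α}` data
  of the new unknown `v_k` and the `C^{m+1,α}` data of the new coefficient map `c♯` on a smaller
  ball, from `C^{m+2,α}` data of `c` and `C^{m+3,α}` data of `v`.

Everything is proved; no definitions, no named facts.  Not here: the difference-quotient step
`C^{2,α} ⇒ C^{3,α}` (interior Schauder theory) and the induction itself.

## References

* D. Gilbarg, N. S. Trudinger, *Elliptic Partial Differential Equations of Second Order*,
  Classics in Mathematics, Springer 2001, §17.4 and Lemma 17.16. [GilbargTrudinger2001]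
-/

noncomputable section

open Function Metric Set Filter
open scoped NNReal ContDiff Topology
open Literature.Analysis.Calculus Literature.Analysis.FunctionSpaces

namespace Literature.Analysis.PDE

/-! ### The linearised structure function `H♯((p, J₀, p₁), J) = DH(p, J₀) · (p₁, J)` -/

section Structure

variable {P Q : Type*} [NormedAddCommGroup P] [NormedSpace ℝ P] [NormedAddCommGroup Q]
  [NormedSpace ℝ Q]

/-- The linearised structure function `((p, J₀, p₁), J) ↦ DH(p, J₀) · (p₁, J)` of a smooth `H`
is smooth. [folklore] -/
theorem contDiff_linearisedStructure {H : P × Q → ℝ} (hH : ContDiff ℝ ∞ H) :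
    ContDiff ℝ ∞ (fun q : (P × (Q × P)) × Q => fderiv ℝ H (q.1.1, q.1.2.1) (q.1.2.2, q.2)) := by
  have h1 : ContDiff ℝ ∞ (fderiv ℝ H) := (contDiff_infty_iff_fderiv.1 hH).2
  exact (h1.comp (contDiff_fst.fst.prodMk contDiff_fst.snd.fst)).clm_apply
    (contDiff_fst.snd.snd.prodMk contDiff_snd)

/-- **The principal symbol of the differentiated equation is that of the original one**: in a
direction `(0, X)` (no variation of the enlarged parameter) the derivative of
`((p, J₀, p₁), J) ↦ DH(p, J₀) · (p₁, J)` at `((p, J₀, p₁), J)` equals `DH(p, J₀) · (0, X)` — the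
`J`-slot enters linearly and the second derivative of `H` is only paired with the zero variation
of `(p, J₀)`. [folklore] -/
theorem fderiv_linearisedStructure_apply_zero {H : P × Q → ℝ} (hH : ContDiff ℝ ∞ H)
    (q : P × (Q × P)) (J X : Q) :
    fderiv ℝ (fun q : (P × (Q × P)) × Q => fderiv ℝ H (q.1.1, q.1.2.1) (q.1.2.2, q.2)) (q, J)
        ((0 : P × (Q × P)), X) = fderiv ℝ H (q.1, q.2.1) ((0 : P), X) := by
  have h1 : ContDiff ℝ ∞ (fderiv ℝ H) := (contDiff_infty_iff_fderiv.1 hH).2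
  have hA := ((hasFDerivAt_fst (𝕜 := ℝ) (p := (q, J))).fst).prodMk
    ((hasFDerivAt_fst (𝕜 := ℝ) (p := (q, J))).snd.fst)
  have hB := ((hasFDerivAt_fst (𝕜 := ℝ) (p := (q, J))).snd.snd).prodMk
    (hasFDerivAt_snd (𝕜 := ℝ) (p := (q, J)))
  have hC : HasFDerivAt (fderiv ℝ H) (fderiv ℝ (fderiv ℝ H) (q.1, q.2.1)) (q.1, q.2.1) :=
    ((h1.differentiable (by simp)).differentiableAt).hasFDerivAt
  have hD := (hC.comp (q, J) hA).clm_apply hB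
  rw [show (fun w : (P × (Q × P)) × Q => fderiv ℝ H (w.1.1, w.1.2.1) (w.1.2.2, w.2)) =
      fun w => ((fderiv ℝ H ∘ fun w : (P × (Q × P)) × Q => (w.1.1, w.1.2.1)) w) (w.1.2.2, w.2)
    from rfl, hD.fderiv]
  simp [Prod.mk_zero_zero]

end Structure

/-! ### Ellipticity of the differentiated equation near the new graph -/

section Elliptic

variable {ι : Type*} [Fintype ι] {E : Type*} [NormedAddCommGroup E]
  [InnerProductSpace ℝ E] {P : Type*} [NormedAddCommGroup P] [NormedSpace ℝ P]

/-- **Ellipticity transfers to the differentiated equation.** If the symbol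
`η ↦ DH(p', J') · (0, η ⊗ η)` is bounded below by `λ ‖η‖²` for all `(p', J')` `δ`-close to the
graph `(c(y), cjet₂ v(y))`, `y ∈ s`, then the symbol of `H♯((p, J₀, p₁), J) = DH(p, J₀) · (p₁, J)`
is bounded below by `λ ‖η‖²` for all `((p, J₀, p₁), J')` with `(p, J₀, p₁)` `δ`-close to
`(c(y), cjet₂ v(y), d(y))` (any `d`, any `J'`): the symbol only sees `(p, J₀)`
(`fderiv_linearisedStructure_apply_zero`), and the sup norm of the product controls the first
components. [folklore] -/
theorem linearisedStructure_elliptic_near (bE : OrthonormalBasis ι ℝ E) {H : P × CJet ι 2 → ℝ}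
    (hH : ContDiff ℝ ∞ H) {c : E → P} {v : E → ℝ} {s : Set E} {l δ : ℝ}
    (hell : ∀ y ∈ s, ∀ (p' : P) (J' : CJet ι 2), ‖p' - c y‖ < δ → ‖J' - cjetOf bE 2 v y‖ < δ →
      ∀ η : E →L[ℝ] ℝ, l * ‖η‖ ^ 2 ≤ fderiv ℝ H (p', J')
        ((0 : P), Pi.single (Fin.last 2) (fun I : Fin 2 → ι => η (bE (I 0)) * η (bE (I 1)))))
    (d : E → P) (w : E → CJet ι 2) :
    ∀ y ∈ s, ∀ (q' : P × (CJet ι 2 × P)) (J' : CJet ι 2),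
      ‖q' - (c y, cjetOf bE 2 v y, d y)‖ < δ → ‖J' - w y‖ < δ →
      ∀ η : E →L[ℝ] ℝ, l * ‖η‖ ^ 2 ≤
        fderiv ℝ (fun q : (P × (CJet ι 2 × P)) × CJet ι 2 =>
          fderiv ℝ H (q.1.1, q.1.2.1) (q.1.2.2, q.2)) (q', J')
          ((0 : P × (CJet ι 2 × P)), Pi.single (Fin.last 2)
            (fun I : Fin 2 → ι => η (bE (I 0)) * η (bE (I 1)))) := by
  intro y hy q' J' hq _ η
  rw [fderiv_linearisedStructure_apply_zero hH]
  refine hell y hy q'.1 q'.2.1 ?_ ?_ η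
  · calc ‖q'.1 - c y‖ = ‖(q' - (c y, cjetOf bE 2 v y, d y)).1‖ := rfl
      _ ≤ ‖q' - (c y, cjetOf bE 2 v y, d y)‖ := norm_fst_le _
      _ < δ := hq
  · calc ‖q'.2.1 - cjetOf bE 2 v y‖ = ‖(q' - (c y, cjetOf bE 2 v y, d y)).2.1‖ := rfl
      _ ≤ ‖(q' - (c y, cjetOf bE 2 v y, d y)).2‖ := norm_fst_le _
      _ ≤ ‖q' - (c y, cjetOf bE 2 v y, d y)‖ := norm_snd_le _
      _ < δ := hq

end Elliptic

/-! ### `C^{n,α}` data of the jet map, the new unknown and the new coefficients -/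

section Data

variable {ι : Type*} [Fintype ι] {E : Type*} [NormedAddCommGroup E] [InnerProductSpace ℝ E]
  {P : Type*} [NormedAddCommGroup P] [NormedSpace ℝ P]

/-- **`C^{n+m,α}` data of `v` on a ball give `C^{n,α}` data of the jet map `cjet_m v`** (each
component `y ↦ Dʲv(y)(e_I)`, `j ≤ m`, is `C^{n,α}` by
`Literature.Analysis.FunctionSpaces.holderData_iteratedFDeriv_apply` after lowering the
order of `v` to `n + j`; the jet space carries the sup norm). [folklore] -/
theorem holderData_cjetOf (bE : OrthonormalBasis ι ℝ E) (m : ℕ) {v : E → ℝ} {x₀ : E} {r : ℝ}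
    {n : ℕ} {α : ℝ≥0} (hα : α ≤ 1) (hv : ContDiffOn ℝ (n + m : ℕ) v (ball x₀ r))
    (hB : ∃ B : ℝ≥0, (∀ y ∈ ball x₀ r, ∀ j ≤ n + m, ‖iteratedFDeriv ℝ j v y‖ ≤ B) ∧
      HolderOnWith B α (iteratedFDeriv ℝ (n + m) v) (ball x₀ r)) :
    ContDiffOn ℝ n (cjetOf bE m v) (ball x₀ r) ∧ ∃ B : ℝ≥0,
      (∀ y ∈ ball x₀ r, ∀ j ≤ n, ‖iteratedFDeriv ℝ j (cjetOf bE m v) y‖ ≤ B) ∧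
      HolderOnWith B α (iteratedFDeriv ℝ n (cjetOf bE m v)) (ball x₀ r) := by
  refine holderData_pi isOpen_ball fun j => holderData_pi isOpen_ball fun I => ?_
  have hlow := holderBallData_of_le (N := n + m) (n := n + j) (by omega) hα hv hB
  exact holderData_iteratedFDeriv_apply isOpen_ball (j : ℕ) (fun t => bE (I t))
    (fun t => (bE.norm_eq_one _).le) hlow.1 hlow.2

/-- **The new unknown**: `C^{m+3,α}` data of `v` on a ball give `C^{2,α}` data of each directional
derivative `z ↦ Dv(z) e_k` there. [folklore] -/
theorem holderData_fderiv_apply_basis_two (bE : OrthonormalBasis ι ℝ E) {v : E → ℝ} {x₀ : E}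
    {r : ℝ} {m : ℕ} {α : ℝ≥0} (hα : α ≤ 1) (hv : ContDiffOn ℝ (m + 3 : ℕ) v (ball x₀ r))
    (hB : ∃ B : ℝ≥0, (∀ y ∈ ball x₀ r, ∀ j ≤ m + 3, ‖iteratedFDeriv ℝ j v y‖ ≤ B) ∧
      HolderOnWith B α (iteratedFDeriv ℝ (m + 3) v) (ball x₀ r)) (k : ι) :
    ContDiffOn ℝ 2 (fun z => fderiv ℝ v z (bE k)) (ball x₀ r) ∧ ∃ B : ℝ≥0,
      (∀ y ∈ ball x₀ r, ∀ j ≤ 2, ‖iteratedFDeriv ℝ j (fun z => fderiv ℝ v z (bE k)) y‖ ≤ B) ∧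
      HolderOnWith B α (iteratedFDeriv ℝ 2 (fun z => fderiv ℝ v z (bE k))) (ball x₀ r) := by
  have h := holderData_fderiv_apply_vector isOpen_ball (bE.norm_eq_one k).le (n := m + 2)
    hv hB
  exact holderBallData_of_le (n := 2) (N := m + 2) (by omega) hα h.1 h.2

/-- **The new coefficient map**: `C^{m+2,α}` data of `c` on `B(x₀, R)` and `C^{m+3,α}` data of
`v` on `B(x₀, ρ₁)`, `ρ₁ ≤ R`, give `C^{m+1,α}` data of
`c♯(y) = (c(y), cjet₂ v(y), Dc(y) e_k)` on `B(x₀, ρ₁)`. [folklore] -/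
theorem holderData_linearisedCoeff (bE : OrthonormalBasis ι ℝ E) {c : E → P} {v : E → ℝ}
    {x₀ : E} {R ρ₁ : ℝ} (hρ₁ : ρ₁ ≤ R) {m : ℕ} {α : ℝ≥0} (hα : α ≤ 1)
    (hc : ContDiffOn ℝ (m + 2 : ℕ) c (ball x₀ R))
    (hcB : ∃ Bc : ℝ≥0, (∀ y ∈ ball x₀ R, ∀ j ≤ m + 2, ‖iteratedFDeriv ℝ j c y‖ ≤ Bc) ∧
      HolderOnWith Bc α (iteratedFDeriv ℝ (m + 2) c) (ball x₀ R))
    (hv : ContDiffOn ℝ (m + 3 : ℕ) v (ball x₀ ρ₁))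
    (hvB : ∃ Bv : ℝ≥0, (∀ y ∈ ball x₀ ρ₁, ∀ j ≤ m + 3, ‖iteratedFDeriv ℝ j v y‖ ≤ Bv) ∧
      HolderOnWith Bv α (iteratedFDeriv ℝ (m + 3) v) (ball x₀ ρ₁)) (k : ι) :
    ContDiffOn ℝ (m + 1 : ℕ) (fun y => (c y, cjetOf bE 2 v y, fderiv ℝ c y (bE k))) (ball x₀ ρ₁) ∧
      ∃ B : ℝ≥0, (∀ y ∈ ball x₀ ρ₁, ∀ j ≤ m + 1,
        ‖iteratedFDeriv ℝ j (fun y => (c y, cjetOf bE 2 v y, fderiv ℝ c y (bE k))) y‖ ≤ B) ∧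
      HolderOnWith B α (iteratedFDeriv ℝ (m + 1)
        (fun y => (c y, cjetOf bE 2 v y, fderiv ℝ c y (bE k)))) (ball x₀ ρ₁) := by
  have hsub : ball x₀ ρ₁ ⊆ ball x₀ R := ball_subset_ball hρ₁
  have hc1 : ContDiffOn ℝ (m + 2 : ℕ) c (ball x₀ ρ₁) := hc.mono hsub
  have hc1B : ∃ Bc : ℝ≥0, (∀ y ∈ ball x₀ ρ₁, ∀ j ≤ m + 2, ‖iteratedFDeriv ℝ j c y‖ ≤ Bc) ∧
      HolderOnWith Bc α (iteratedFDeriv ℝ (m + 2) c) (ball x₀ ρ₁) := by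
    obtain ⟨Bc, h1, h2⟩ := hcB
    exact ⟨Bc, fun y hy j hj => h1 y (hsub hy) j hj, h2.mono hsub⟩
  have hA := holderBallData_of_le (N := m + 2) (n := m + 1) (by omega) hα hc1 hc1B
  have hJ := holderData_cjetOf bE 2 (n := m + 1) hα hv hvB
  have hD := holderData_fderiv_apply_vector isOpen_ball (bE.norm_eq_one k).le (n := m + 1)
    hc1 hc1B
  exact holderData_prodMk isOpen_ball hA (holderData_prodMk isOpen_ball hJ hD)

end Data

end Literature.Analysis.PDE
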